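import Literature.Computability.Complexity.ZIntBricks
import Literature.Computability.Complexity.PlumbingBricks

/-!
# Crux `ArithStatLadder.IqThreeNotPPoly` (stmt-QuantumAdvantage-2422)

Stub `stub_samplerNG` of the line `Sketch` (skeleton v4): the sampler of the planted Nagell family
is a polynomial-time string function.

On an input pair `⟨x, r⟩` (numeral `x`, `N = ⟦x⟧ = bitsToNat x`, and seed `r`, `k = ⟦r⟧`) it
outputs the canonical numeral of `d = N · s · (4 c³ ∸ N · s)` with `c = 1 + 2³⁰ N⁵` and
`s = 1 + 6 c N k` (so that `d = 4 c⁶ − (2 c³ − N s)²` whenever the truncated subtraction `∸` does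
not truncate).

The witness is an explicit composition of the tree's natural-number `FP` bricks (no machine is
written, and no sign analysis is needed: the statement's `-` is truncated subtraction in `ℕ`, which
is exactly the brick `subFn`, `subFn_boolPair`):
* `N` and `k` are the values of `fstF`, `sndF` (`fstF_boolPair`, `sndF_boolPair`);
* numeral-valued expressions are closed under constants (`const_mem_FP`, `bitsToNat_encodeNat`),
  products (`prodFn`), sums (`addFn`), truncated differences (`subFn`) and hence powers, the value
  of an expression `m` being tracked as `bitsToNat (m z)` (`exists_nval_*` below);
* the output is the product brick `prodFn` applied to the expressions for `N s` and `4 c³ ∸ N s`,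
  whose output is already a canonical numeral (`prodFn_boolPair`).
Membership in `FP` is by the closure lemmas `comp_mem_FP`, `fanoutFn_mem_FP`, `const_mem_FP`; the
closed form holds on every input (all functions are total).
-/

noncomputable section

set_option linter.dupNamespace false -- D-0017: single-problem summit ⇒ `QuantumAdvantage.QuantumAdvantage` by design

namespace Summit.QuantumAdvantage.QuantumAdvantage.Theorems.IqThreeNotPPoly

open scoped Classical
open _root_.Computability Literature.Computability.Complexity
open Literature.Computability.Complexity.Brick

/-! ### Numeral-valued `FP` expressions (values tracked through `bitsToNat`) -/

/-- A brick `p ∈ FP` is a numeral-valued expression of value `⟦p z⟧`. -/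
private theorem exists_nval_self {p : List Bool → List Bool} (hp : p ∈ FP) :
    ∃ m ∈ FP, ∀ z, bitsToNat (m z) = bitsToNat (p z) :=
  ⟨p, hp, fun _ => rfl⟩

/-- Natural constants are `FP` expressions (the constant canonical numeral). -/
private theorem exists_nval_const (c : ℕ) : ∃ m ∈ FP, ∀ z, bitsToNat (m z) = c :=
  ⟨fun _ => encodeNat c, const_mem_FP _, fun _ => bitsToNat_encodeNat c⟩

/-- Products of `FP` expressions (`prodFn`). -/
private theorem exists_nval_mul {φ ψ : List Bool → ℕ}
    (hφ : ∃ m ∈ FP, ∀ z, bitsToNat (m z) = φ z) (hψ : ∃ m ∈ FP, ∀ z, bitsToNat (m z) = ψ z) :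
    ∃ m ∈ FP, ∀ z, bitsToNat (m z) = φ z * ψ z := by
  obtain ⟨p, hp, hpv⟩ := hφ
  obtain ⟨q, hq, hqv⟩ := hψ
  exact ⟨prodFn ∘ fanoutFn p q, comp_mem_FP prodFn_mem_FP (fanoutFn_mem_FP hp hq), fun z => by
    rw [Function.comp_apply, fanoutFn_apply, prodFn_boolPair, bitsToNat_encodeNat, hpv, hqv]⟩

/-- Sums of `FP` expressions (`addFn`). -/
private theorem exists_nval_add {φ ψ : List Bool → ℕ}
    (hφ : ∃ m ∈ FP, ∀ z, bitsToNat (m z) = φ z) (hψ : ∃ m ∈ FP, ∀ z, bitsToNat (m z) = ψ z) :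
    ∃ m ∈ FP, ∀ z, bitsToNat (m z) = φ z + ψ z := by
  obtain ⟨p, hp, hpv⟩ := hφ
  obtain ⟨q, hq, hqv⟩ := hψ
  exact ⟨addFn ∘ fanoutFn p q, comp_mem_FP addFn_mem_FP (fanoutFn_mem_FP hp hq), fun z => by
    rw [Function.comp_apply, fanoutFn_apply, addFn_boolPair, bitsToNat_encodeNat, hpv, hqv]⟩

/-- Truncated differences of `FP` expressions (`subFn`). -/
private theorem exists_nval_sub {φ ψ : List Bool → ℕ}
    (hφ : ∃ m ∈ FP, ∀ z, bitsToNat (m z) = φ z) (hψ : ∃ m ∈ FP, ∀ z, bitsToNat (m z) = ψ z) :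
    ∃ m ∈ FP, ∀ z, bitsToNat (m z) = φ z - ψ z := by
  obtain ⟨p, hp, hpv⟩ := hφ
  obtain ⟨q, hq, hqv⟩ := hψ
  exact ⟨subFn ∘ fanoutFn p q, comp_mem_FP subFn_mem_FP (fanoutFn_mem_FP hp hq), fun z => by
    rw [Function.comp_apply, fanoutFn_apply, subFn_boolPair, bitsToNat_encodeNat, hpv, hqv]⟩

/-- Powers of an `FP` expression (iterated `prodFn`, the exponent a fixed natural). -/
private theorem exists_nval_pow {φ : List Bool → ℕ} (hφ : ∃ m ∈ FP, ∀ z, bitsToNat (m z) = φ z) :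
    ∀ n : ℕ, ∃ m ∈ FP, ∀ z, bitsToNat (m z) = φ z ^ n
  | 0 => by
    obtain ⟨m, hm, hmv⟩ := exists_nval_const 1
    exact ⟨m, hm, fun z => by rw [hmv, pow_zero]⟩
  | n + 1 => by
    obtain ⟨m, hm, hmv⟩ := exists_nval_mul (exists_nval_pow hφ n) hφ
    exact ⟨m, hm, fun z => by rw [hmv, pow_succ]⟩

/-! ### The registered stub -/

/-- **STUB · `stub_samplerNG`.** The sampler of the planted Nagell family — on `⟨x, r⟩`, with
`N = ⟦x⟧`, `k = ⟦r⟧`, `c = 1 + 2³⁰ N⁵`, `s = 1 + 6 c N k`, output the canonical numeral of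
`N s (4 c³ ∸ N s)` — is a polynomial-time string function: the product brick `prodFn` of the
numeral-valued `FP` expressions for `N s` and for the truncated difference `4 c³ ∸ N s`
(`exists_nval_mul/add/sub/pow/const` over the projections `fstF`, `sndF`). -/
theorem stub_samplerNG :
    ∃ f : List Bool → List Bool, f ∈ FP ∧ ∀ x r : List Bool,
      f (boolPair x r) = encodeNat (bitsToNat x * (1 + 6 * (1 + 2 ^ 30 * bitsToNat x ^ 5) * bitsToNat x * bitsToNat r) *
        (4 * (1 + 2 ^ 30 * bitsToNat x ^ 5) ^ 3 -
          bitsToNat x * (1 + 6 * (1 + 2 ^ 30 * bitsToNat x ^ 5) * bitsToNat x * bitsToNat r))) := by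
  have hN : ∃ m ∈ FP, ∀ z, bitsToNat (m z) = bitsToNat (fstF z) := exists_nval_self fstF_mem_FP
  have hK : ∃ m ∈ FP, ∀ z, bitsToNat (m z) = bitsToNat (sndF z) := exists_nval_self sndF_mem_FP
  -- `c = 1 + 2³⁰ N⁵`
  have hC := exists_nval_add (exists_nval_const 1)
    (exists_nval_mul (exists_nval_const (2 ^ 30)) (exists_nval_pow hN 5))
  -- `N s`, `s = 1 + 6 c N k`
  have hNS := exists_nval_mul hN (exists_nval_add (exists_nval_const 1)
    (exists_nval_mul (exists_nval_mul (exists_nval_mul (exists_nval_const 6) hC) hN) hK))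
  -- `4 c³ ∸ N s`
  have hW := exists_nval_sub (exists_nval_mul (exists_nval_const 4) (exists_nval_pow hC 3)) hNS
  obtain ⟨p, hp, hpv⟩ := hNS
  obtain ⟨q, hq, hqv⟩ := hW
  refine ⟨prodFn ∘ fanoutFn p q, comp_mem_FP prodFn_mem_FP (fanoutFn_mem_FP hp hq), fun x r => ?_⟩
  rw [Function.comp_apply, fanoutFn_apply, prodFn_boolPair, hpv, hqv, fstF_boolPair, sndF_boolPair]

end Summit.QuantumAdvantage.QuantumAdvantage.Theorems.IqThreeNotPPoly

end
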